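import Summits.AtomisticToContinuum.Crystallization.Theorems.HullExactificationCascadeHcpLandscapeGapStubGoodOfNoBadBond
import Summits.AtomisticToContinuum.Crystallization.Theorems.PricedLinkCensusStackingHingeUnmatchedNearBadBond
import Literature.MathematicalPhysics.StatisticalMechanics.BarlowStackingHeights
import Literature.MathematicalPhysics.StatisticalMechanics.HcpHomogeneous

/-!
# Crux `HcpLandscapeGap` (route `HullExactificationCascade`, stmt-AtomisticToContinuum-12087),
# line `birth`: stub `stub_goodOfNoBadBondHeights` (RG) — no bad bond and near-`h` spacings
# nearby ⇒ a `Good(4, θ)` chart, for Barlow MULTILATTICES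

Heights analogue of G1 (`HcpLandscapeGapBirth.stub_goodOfNoBadBond`).  Fix the reference scale
`(a, h)`, `a, h > 0`, and `θ > 0`.  There are `δ₁ > 0` and `K : ℕ` such that: for every in-layer
scale `a'` with `|a' − a| ≤ δ₁`, every Hägg word `s`, every height profile `H : ℤ → ℝ` with all
gaps `H (k+1) − H k ≥ h/2`, and every site `p = barlowPosH a' H s m i j` whose layer `m` has no
bad bond (`s (k+1) = s k`) and only `δ₁`-almost-`h` spacings (`|H (k+1) − H k − h| ≤ δ₁`) for
`|k − m| ≤ K`, the radius-`4` neighbourhood of `p` in the multilattice `barlowStackingH a' H s` is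
two-way `θ`-matched with `p + A₂ '' (hcpStacking a h ∩ B̄(0, 4))` for a LINEAR isometry `A₂`.

Proof.  Compare with the UNIFORM stacking `barlowStacking a' h s` of the same word: the point
`(k, i', j')` of the multilattice is the uniform point `(k, i', j')` lifted by `H k − k h`, so
relative to the base points `p` resp. `P = barlowPos a' h s m i j` the two differ by the vertical
vector of length `|H k − H m − (k − m) h| ≤ |k − m| δ₁ ≤ K δ₁ ≤ θ/2` (telescoping,
`abs_sub_le_of_steps`) as long as `|k − m| ≤ K`; the layers meeting the two windows have
`|k − m| ≤ K` by the gap `h/2` (`sub_le_of_gap_le`) resp. by `x₃ = k h` in the uniform stacking.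
The uniform stacking re-based at `P` is `barlowStacking a' h (s (· + m))` with base point `0`
(`mem_barlowStacking_iff_sub_mem_shift`); `matched_of_noBadBond` (radius `R = 4 + θ/2`,
tolerance `ε = θ/4`) two-way matches its `R`-window with an affine image of `hcpStacking a h`, and
`exists_linearChart_of_matched_radius` (the radius-`R` variant of G1's
`exists_linearChart_of_matched`: hcp partner `z₀` of `0`, `hcpStacking_homogeneous` at `z₀`,
linear part of the affine isometry) turns this into a linear chart `A₂` with tolerance `2ε = θ/2`.
The remaining `θ/2` absorbs the vertical discrepancy.  All `[folklore]`.
-/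

noncomputable section

namespace Summit.AtomisticToContinuum.Crystallization.Theorems.HcpLandscapeGapBirth

open Literature.MathematicalPhysics.StatisticalMechanics
open Summit.AtomisticToContinuum.Crystallization.Theorems.PricedHcpWindowsIdealGeometry
  (matched_of_noBadBond)

/-- The vertical vector `layerNormal t = (0, 0, t)` has norm `|t|`. [folklore] -/
theorem norm_layerNormal (t : ℝ) : ‖(layerNormal t : EuclideanSpace ℝ (Fin 3))‖ = |t| := by
  rw [EuclideanSpace.norm_eq, Fin.sum_univ_three]
  simp [layerNormal, Real.sqrt_sq_eq_abs]

/-- **Multilattice vs uniform stacking, relative to base points.**  For the site `(k, i', j')`,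
`barlowPosH a' H s k i' j' − barlowPosH a' H s m i j
  = (barlowPos a' h s k i' j' − barlowPos a' h s m i j) + (H k − H m − (k − m) h) e₃`. [folklore] -/
theorem barlowPosH_sub_barlowPosH_eq (a' h : ℝ) (H : ℤ → ℝ) (s : ℤ → ℤ) (m i j k i' j' : ℤ) :
    barlowPosH a' H s k i' j' - barlowPosH a' H s m i j =
      (barlowPos a' h s k i' j' - barlowPos a' h s m i j) +
        layerNormal (H k - H m - ((k : ℝ) - m) * h) := by
  ext l
  fin_cases l <;> simp [layerNormal]
  ring

/-- **Telescoping.**  If `|G (l+1) − G l| ≤ δ` for all `l` with `|l − m| ≤ K`, then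
`|G k − G m| ≤ K δ` for `|k − m| ≤ K`. [folklore] -/
theorem abs_sub_le_of_steps {G : ℤ → ℝ} {δ : ℝ} {m : ℤ} {K : ℕ}
    (hG : ∀ l : ℤ, |l - m| ≤ K → |G (l + 1) - G l| ≤ δ) {k : ℤ} (hk : |k - m| ≤ K) :
    |G k - G m| ≤ K * δ := by
  have hδ : 0 ≤ δ := (abs_nonneg _).trans (hG m (by simp))
  rcases le_total m k with hmk | hkm
  · -- `k = m + n`
    obtain ⟨n, rfl⟩ : ∃ n : ℕ, k = m + n := ⟨(k - m).toNat, by omega⟩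
    have hn : (n : ℤ) ≤ K := by rw [add_sub_cancel_left] at hk; exact (le_abs_self _).trans hk
    have key : ∀ n : ℕ, (n : ℤ) ≤ K → |G (m + n) - G m| ≤ n * δ := by
      intro n
      induction n with
      | zero => intro; simp
      | succ n ih =>
        intro hn
        push_cast at hn
        have hnK : (n : ℤ) ≤ K := by omega
        have h1 := ih hnK
        have h2 := hG (m + n) (by rwa [add_sub_cancel_left, abs_of_nonneg (by positivity)])
        have e : (m : ℤ) + ((n + 1 : ℕ) : ℤ) = m + n + 1 := by push_cast; ring
        rw [e]
        calc |G (m + n + 1) - G m| = |(G (m + n + 1) - G (m + n)) + (G (m + n) - G m)| := by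
              ring_nf
          _ ≤ |G (m + n + 1) - G (m + n)| + |G (m + n) - G m| := abs_add_le _ _
          _ ≤ δ + n * δ := add_le_add h2 h1
          _ = ((n + 1 : ℕ) : ℝ) * δ := by push_cast; ring
    calc |G (m + n) - G m| ≤ n * δ := key n hn
      _ ≤ K * δ := mul_le_mul_of_nonneg_right (by exact_mod_cast hn) hδ
  · -- `k = m - n`
    obtain ⟨n, rfl⟩ : ∃ n : ℕ, k = m - n := ⟨(m - k).toNat, by omega⟩
    have hn : (n : ℤ) ≤ K := by
      rw [sub_sub_cancel_left, abs_neg] at hk; exact (le_abs_self _).trans hk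
    have key : ∀ n : ℕ, (n : ℤ) ≤ K → |G (m - n) - G m| ≤ n * δ := by
      intro n
      induction n with
      | zero => intro; simp
      | succ n ih =>
        intro hn
        push_cast at hn
        have hnK : (n : ℤ) ≤ K := by omega
        have h1 := ih hnK
        have h2 := hG (m - n - 1) (by
          rw [show m - (n : ℤ) - 1 - m = -((n : ℤ) + 1) by ring, abs_neg,
            abs_of_nonneg (by positivity)]
          exact hn)
        have e : (m : ℤ) - ((n + 1 : ℕ) : ℤ) = m - n - 1 := by push_cast; ring
        rw [sub_add_cancel] at h2
        rw [e]
        calc |G (m - n - 1) - G m| = |-(G (m - n) - G (m - n - 1)) + (G (m - n) - G m)| := by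
              ring_nf
          _ ≤ |-(G (m - n) - G (m - n - 1))| + |G (m - n) - G m| := abs_add_le _ _
          _ ≤ δ + n * δ := add_le_add (by rw [abs_neg]; exact h2) h1
          _ = ((n + 1 : ℕ) : ℝ) * δ := by push_cast; ring
    calc |G (m - n) - G m| ≤ n * δ := key n hn
      _ ≤ K * δ := mul_le_mul_of_nonneg_right (by exact_mod_cast hn) hδ

/-- **A linear chart from an affine matching at the origin, radius-`R` variant** of
`exists_linearChart_of_matched`.  If an affine isometry `g` of `ℝ³` two-way `ε`-matches the
`R`-window of the point `0 ∈ S'` with `g '' hcpStacking a h` (`0 ≤ ε`, `4 + ε ≤ R`), then for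
some linear isometry `A`: every hcp point `q` of norm `≤ 4` has a point of `S'` within `2ε` of
`A q`, and every point of `S'` of norm `≤ R` has `A q`, `q` hcp, within `2ε` (hcp partner `z₀` of
`0`, `hcpStacking_homogeneous` at `z₀`, `A = L ∘ Bh` with `L` the linear part of `g`).
[folklore] -/
theorem exists_linearChart_of_matched_radius {a h R ε : ℝ} (hε : 0 ≤ ε) (hR : 4 + ε ≤ R)
    {S' : Set (EuclideanSpace ℝ (Fin 3))} (h0 : (0 : EuclideanSpace ℝ (Fin 3)) ∈ S')
    {g : EuclideanSpace ℝ (Fin 3) ≃ᵃⁱ[ℝ] EuclideanSpace ℝ (Fin 3)}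
    (h1 : ∀ y ∈ S', dist 0 y ≤ R → ∃ z ∈ hcpStacking a h, dist y (g z) ≤ ε)
    (h2 : ∀ z ∈ hcpStacking a h, dist 0 (g z) ≤ R → ∃ y ∈ S', dist y (g z) ≤ ε) :
    ∃ A : EuclideanSpace ℝ (Fin 3) →ₗᵢ[ℝ] EuclideanSpace ℝ (Fin 3),
      (∀ q ∈ hcpStacking a h, ‖q‖ ≤ 4 → ∃ y ∈ S', dist y (A q) ≤ 2 * ε) ∧
      (∀ y ∈ S', ‖y‖ ≤ R → ∃ q ∈ hcpStacking a h, dist y (A q) ≤ 2 * ε) := by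
  -- adapted from `exists_linearChart_of_matched` (G1), second clause at radius `R`
  obtain ⟨z₀, hz₀, hd₀⟩ := h1 0 h0 (by rw [dist_self]; linarith)
  rw [dist_zero_left] at hd₀
  obtain ⟨Bh, hBh⟩ := hcpStacking_homogeneous a h hz₀
  set L := g.linearIsometryEquiv with hL
  have hg : ∀ w, g (z₀ + w) = g z₀ + L w := fun w => by
    have e := g.map_vadd z₀ w
    simp only [vadd_eq_add] at e
    rw [add_comm z₀ w, e, add_comm]
  have hnear : ∀ w, dist (g (z₀ + w)) (L w) ≤ ε := fun w => by
    rw [hg, dist_add_self_left]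
    exact hd₀
  refine ⟨L.toLinearIsometry.comp Bh.toLinearIsometry, ?_, ?_⟩
  · intro q hq hq4
    have hzq : z₀ + Bh q ∈ hcpStacking a h := (hBh q).1 hq
    have hdist : dist 0 (g (z₀ + Bh q)) ≤ R := by
      rw [hg, dist_zero_left]
      calc ‖g z₀ + L (Bh q)‖ ≤ ‖g z₀‖ + ‖L (Bh q)‖ := norm_add_le _ _
        _ = ‖g z₀‖ + ‖q‖ := by rw [L.norm_map, Bh.norm_map]
        _ ≤ R := by linarith
    obtain ⟨y, hy, hyd⟩ := h2 _ hzq hdist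
    refine ⟨y, hy, ?_⟩
    show dist y (L (Bh q)) ≤ 2 * ε
    calc dist y (L (Bh q)) ≤ dist y (g (z₀ + Bh q)) + dist (g (z₀ + Bh q)) (L (Bh q)) :=
          dist_triangle _ _ _
      _ ≤ ε + ε := add_le_add hyd (hnear _)
      _ = 2 * ε := by ring
  · intro y hy hyR
    have hdist : dist 0 y ≤ R := by rwa [dist_zero_left]
    obtain ⟨z, hz, hzd⟩ := h1 y hy hdist
    refine ⟨Bh.symm (z - z₀), ?_, ?_⟩
    · rw [hBh, LinearIsometryEquiv.apply_symm_apply, add_sub_cancel]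
      exact hz
    · show dist y (L (Bh (Bh.symm (z - z₀)))) ≤ 2 * ε
      rw [LinearIsometryEquiv.apply_symm_apply]
      have hgz : g z = g (z₀ + (z - z₀)) := by rw [add_sub_cancel]
      calc dist y (L (z - z₀)) ≤ dist y (g z) + dist (g z) (L (z - z₀)) := dist_triangle _ _ _
        _ ≤ ε + ε := add_le_add hzd (by rw [hgz]; exact hnear _)
        _ = 2 * ε := by ring

/-- **Stub RG — no bad bond and near-`h` spacings nearby ⇒ `Good(4, θ)` after a linear isometry,
for Barlow multilattices** (heights analogue of G1 `stub_goodOfNoBadBond`).  For `a, h > 0` and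
`θ > 0` there are `δ₁ > 0` and `K : ℕ` (`R = 4 + θ/2`, `ε = θ/4`, `K = ⌈2(R + ε)/h⌉₊`,
`δ₁ = min (min (a/2) (h/2)) (min (ε/(2R(1/a + 1/h) + 1)) (θ/(2K + 1)))`) such that for every
`a'` with `|a' − a| ≤ δ₁`, every Hägg word `s`, every height profile `H` with gaps `≥ h/2`, and
every site `p = barlowPosH a' H s m i j` with no bad bond `s (k+1) = s k` and spacings
`|H (k+1) − H k − h| ≤ δ₁` for `|k − m| ≤ K`: for some linear isometry `A₂`, (1) every hcp point
`q` of norm `≤ 4` has a point `z` of `barlowStackingH a' H s` with `dist z p ≤ 4 + θ` and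
`dist z (p + A₂ q) ≤ θ`, and (2) every multilattice point `z` with `dist z p ≤ 4` has an hcp
point `q` with `dist z (p + A₂ q) ≤ θ` (compare with the uniform stacking `barlowStacking a' h s`
re-based at `barlowPos a' h s m i j`: vertical discrepancy `≤ K δ₁ ≤ θ/2` on the layers
`|k − m| ≤ K` that meet the windows; `matched_of_noBadBond` + `exists_linearChart_of_matched_radius`
with tolerance `2ε = θ/2`). [folklore] -/
theorem stub_goodOfNoBadBondHeights : ∀ (a h : ℝ), 0 < a → 0 < h → ∀ θ : ℝ, 0 < θ → ∃ δ₁ : ℝ, 0 < δ₁ ∧ ∃ K : ℕ, ∀ a' : ℝ, |a' - a| ≤ δ₁ → ∀ s : ℤ → ℤ, Literature.MathematicalPhysics.StatisticalMechanics.IsHaggSeq s → ∀ H : ℤ → ℝ, (∀ k : ℤ, h / 2 ≤ H (k + 1) - H k) → ∀ m i j : ℤ, (∀ k : ℤ, |k - m| ≤ K → s (k + 1) ≠ s k) → (∀ k : ℤ, |k - m| ≤ K → |H (k + 1) - H k - h| ≤ δ₁) → ∃ A₂ : EuclideanSpace ℝ (Fin 3) →ₗᵢ[ℝ] EuclideanSpace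 ℝ (Fin 3), (∀ q ∈ Literature.MathematicalPhysics.StatisticalMechanics.hcpStacking a h, ‖q‖ ≤ 4 → ∃ z ∈ Literature.MathematicalPhysics.StatisticalMechanics.barlowStackingH a' H s, dist z (Literature.MathematicalPhysics.StatisticalMechanics.barlowPosH a' H s m i j) ≤ 4 + θ ∧ dist z (Literature.MathematicalPhysics.StatisticalMechanics.barlowPosH a' H s m i j + A₂ q) ≤ θ) ∧ (∀ z ∈ Literature.MathematicalPhysics.StatisticalMechanics.barlowStackingH a' H s, dist z (Literature.MathematicalPhysics.StatisticalMechanics.barlowPosH a' H s m i j) ≤ 4 → ∃ q ∈ Literature.MathematicalPhysics.StatisticalMechanics.hcpStacking a h, dist z (Literature.MathematicalPhysics.StatisticalMechanics.barlowPosH a' H s m i j + A₂ q) ≤ θ) := by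
  intro a h ha hh θ hθ
  -- constants: `R = 4 + θ/2`, `ε = θ/4`, `K = ⌈2(R + ε)/h⌉₊`, then `δ₁` with `K δ₁ ≤ θ/2`
  set R : ℝ := 4 + θ / 2 with hR
  set ε : ℝ := θ / 4 with hε
  have hε0 : 0 < ε := by positivity
  have hR0 : 0 < R := by positivity
  have hM : 0 ≤ 2 * R * (1 / a + 1 / h) := by positivity
  set K : ℕ := ⌈2 * (R + ε) / h⌉₊ with hKdef
  have hK : R + ε ≤ (K : ℝ) * (h / 2) := by
    have h1 := Nat.le_ceil (2 * (R + ε) / h)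
    calc R + ε = 2 * (R + ε) / h * (h / 2) := by field_simp
      _ ≤ _ := mul_le_mul_of_nonneg_right h1 (by positivity)
  have hK0 : (0 : ℝ) ≤ K := Nat.cast_nonneg _
  refine ⟨min (min (a / 2) (h / 2)) (min (ε / (2 * R * (1 / a + 1 / h) + 1)) (θ / (2 * K + 1))),
    by positivity, K, ?_⟩
  intro a' haδ s hs H hgap m i j hgood hH
  set δ₁ : ℝ := min (min (a / 2) (h / 2)) (min (ε / (2 * R * (1 / a + 1 / h) + 1)) (θ / (2 * K + 1)))
    with hδ₁
  -- the scale bounds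
  have hδa : δ₁ ≤ a / 2 := (min_le_left _ _).trans (min_le_left _ _)
  have hδh : δ₁ ≤ h / 2 := (min_le_left _ _).trans (min_le_right _ _)
  have hδ0 : 0 ≤ δ₁ := (abs_nonneg _).trans haδ
  have hδε : δ₁ * (2 * R * (1 / a + 1 / h)) ≤ ε := by
    calc δ₁ * (2 * R * (1 / a + 1 / h))
        ≤ ε / (2 * R * (1 / a + 1 / h) + 1) * (2 * R * (1 / a + 1 / h)) :=
          mul_le_mul_of_nonneg_right ((min_le_right _ _).trans (min_le_left _ _)) hM
      _ ≤ ε := by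
          rw [div_mul_eq_mul_div, div_le_iff₀ (by positivity)]
          nlinarith
  have hKδ : (K : ℝ) * δ₁ ≤ θ / 2 := by
    calc (K : ℝ) * δ₁ ≤ K * (θ / (2 * K + 1)) :=
          mul_le_mul_of_nonneg_left ((min_le_right _ _).trans (min_le_right _ _)) hK0
      _ ≤ θ / 2 := by
          rw [mul_div_assoc', div_le_div_iff₀ (by positivity) (by positivity)]
          nlinarith
  have ha' : a' ≠ 0 := by
    intro h0
    rw [h0, zero_sub, abs_neg, abs_of_pos ha] at haδ
    linarith
  have hhδ : |h - h| ≤ δ₁ := by rwa [sub_self, abs_zero]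
  -- re-base the word at layer `m`: `s' = s (· + m)` has no bad bond within `K` of `0`
  set s' : ℤ → ℤ := fun n => s (n + m) with hs'
  have hs'H : IsHaggSeq s' := isHaggSeq_shift hs m
  have hgood' : ∀ k : ℤ, |k - 0| ≤ (K : ℕ) → s' (k + 1) ≠ s' k := by
    intro k hk
    have hk' : |k + m - m| ≤ (K : ℕ) := by rwa [add_sub_cancel_right, ← sub_zero k]
    have e := hgood (k + m) hk'
    simp only [hs']
    rwa [show k + 1 + m = k + m + 1 by ring]
  obtain ⟨g, hg1, hg2⟩ := matched_of_noBadBond ha hh hε0.le hδa hδh hδε hK ha' hh.ne' haδ hhδ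
    hs'H (m := 0) hgood'
  have hx0 : barlowPos a' h s' 0 0 0 = 0 := by simp [barlowPos]
  have h0 : (0 : EuclideanSpace ℝ (Fin 3)) ∈ barlowStacking a' h s' := hx0 ▸ barlowPos_mem 0 0 0
  rw [hx0] at hg1 hg2
  -- the linear chart at the origin of the re-based uniform stacking
  obtain ⟨A, hA1, hA2⟩ := exists_linearChart_of_matched_radius (a := a) (h := h) hε0.le
    (show 4 + ε ≤ R by rw [hR, hε]; linarith) h0 hg1 hg2
  -- base points and the vertical discrepancy
  set P := barlowPos a' h s m i j with hP
  set p := barlowPosH a' H s m i j with hp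
  have hkey : ∀ k i' j' : ℤ, barlowPosH a' H s k i' j' - p =
      (barlowPos a' h s k i' j' - P) + layerNormal (H k - H m - ((k : ℝ) - m) * h) :=
    fun k i' j' => barlowPosH_sub_barlowPosH_eq a' h H s m i j k i' j'
  have hvert : ∀ k : ℤ, |k - m| ≤ (K : ℤ) →
      ‖(layerNormal (H k - H m - ((k : ℝ) - m) * h) : EuclideanSpace ℝ (Fin 3))‖ ≤ θ / 2 := by
    intro k hk
    rw [norm_layerNormal]
    have h1 := abs_sub_le_of_steps (G := fun l : ℤ => H l - (l : ℝ) * h) (δ := δ₁) (m := m)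
      (K := K) (fun l hl => by
        have e : H (l + 1) - (((l + 1 : ℤ)) : ℝ) * h - (H l - (l : ℝ) * h) = H (l + 1) - H l - h := by
          push_cast; ring
        rw [e]
        exact hH l hl) hk
    have e : H k - (k : ℝ) * h - (H m - (m : ℝ) * h) = H k - H m - ((k : ℝ) - m) * h := by ring
    rw [e] at h1
    exact h1.trans hKδ
  have hθε : 2 * ε + θ / 2 = θ := by rw [hε]; ring
  refine ⟨A, ?_, ?_⟩
  · -- clause 1: an hcp point `q` of norm `≤ 4`
    intro q hq hq4
    obtain ⟨y, hy, hyd⟩ := hA1 q hq hq4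
    obtain ⟨k', i', j', rfl⟩ := hy
    have hny : ‖barlowPos a' h s' k' i' j'‖ ≤ 4 + 2 * ε := by
      calc ‖barlowPos a' h s' k' i' j'‖
          ≤ ‖barlowPos a' h s' k' i' j' - A q‖ + ‖A q‖ := norm_le_norm_sub_add _ _
        _ ≤ 2 * ε + 4 := by rw [← dist_eq_norm, A.norm_map]; exact add_le_add hyd hq4
        _ = 4 + 2 * ε := by ring
    -- its layer `k' + m` has `|k'| ≤ K`
    have hk' : |k' + m - m| ≤ (K : ℤ) := by
      rw [add_sub_cancel_right]
      have h2 : |(k' : ℝ) * h| ≤ 4 + 2 * ε := by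
        have h3 := PiLp.norm_apply_le (barlowPos a' h s' k' i' j') 2
        rw [barlowPos_apply_two, Real.norm_eq_abs] at h3
        exact h3.trans hny
      rw [abs_mul, abs_of_pos hh] at h2
      have h3 : |(k' : ℝ)| * h ≤ K * h := by
        calc |(k' : ℝ)| * h ≤ 4 + 2 * ε := h2
          _ = R := by rw [hR, hε]; ring
          _ ≤ R + ε := le_add_of_nonneg_right hε0.le
          _ ≤ K * (h / 2) := hK
          _ ≤ K * h := by nlinarith
      have h4 : |(k' : ℝ)| ≤ K := le_of_mul_le_mul_right h3 hh
      exact_mod_cast h4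
    have hyP : barlowPos a' h s (k' + m) (i' + i) (j' + j) - P = barlowPos a' h s' k' i' j' := by
      rw [hP, ← barlowPos_add_barlowPos_shift, add_sub_cancel_left]
    have hzp := hkey (k' + m) (i' + i) (j' + j)
    rw [hyP] at hzp
    refine ⟨barlowPosH a' H s (k' + m) (i' + i) (j' + j), barlowPosH_mem _ _ _, ?_, ?_⟩
    · rw [dist_eq_norm, hzp]
      calc ‖barlowPos a' h s' k' i' j' + layerNormal (H (k' + m) - H m - (((k' + m : ℤ) : ℝ) - m) * h)‖
          ≤ ‖barlowPos a' h s' k' i' j'‖ +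
              ‖(layerNormal (H (k' + m) - H m - (((k' + m : ℤ) : ℝ) - m) * h) : EuclideanSpace ℝ (Fin 3))‖ :=
            norm_add_le _ _
        _ ≤ (4 + 2 * ε) + θ / 2 := add_le_add hny (hvert _ hk')
        _ = 4 + θ := by rw [hε]; ring
    · rw [dist_eq_norm, ← sub_sub, hzp, add_sub_right_comm]
      calc ‖barlowPos a' h s' k' i' j' - A q +
              layerNormal (H (k' + m) - H m - (((k' + m : ℤ) : ℝ) - m) * h)‖
          ≤ ‖barlowPos a' h s' k' i' j' - A q‖ +
              ‖(layerNormal (H (k' + m) - H m - (((k' + m : ℤ) : ℝ) - m) * h) : EuclideanSpace ℝ (Fin 3))‖ :=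
            norm_add_le _ _
        _ ≤ 2 * ε + θ / 2 := add_le_add (by rw [← dist_eq_norm]; exact hyd) (hvert _ hk')
        _ = θ := hθε
  · -- clause 2: a multilattice point `z` with `dist z p ≤ 4`
    intro z hz hz4
    obtain ⟨k, i', j', rfl⟩ := hz
    -- its layer has `|k - m| ≤ K` by the gap `h/2`
    have hHk : |H k - H m| ≤ 4 := by
      have h3 := PiLp.dist_apply_le (barlowPosH a' H s k i' j') p 2
      rw [hp, barlowPosH_apply_two, barlowPosH_apply_two, Real.dist_eq] at h3
      exact h3.trans hz4
    have hkm : |k - m| ≤ (K : ℤ) := by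
      have h1 : |(k : ℝ) - m| * (h / 2) ≤ |H k - H m| := by
        rcases le_total m k with hmk | hkm
        · have h2 := sub_le_of_gap_le H hgap hmk
          have h3 : (0 : ℝ) ≤ (k : ℝ) - m := by
            have : (m : ℝ) ≤ k := by exact_mod_cast hmk
            linarith
          rw [abs_of_nonneg h3]
          exact h2.trans (le_abs_self _)
        · have h2 := sub_le_of_gap_le H hgap hkm
          have h3 : (0 : ℝ) ≤ (m : ℝ) - k := by
            have : (k : ℝ) ≤ m := by exact_mod_cast hkm
            linarith
          rw [abs_sub_comm, abs_of_nonneg h3, abs_sub_comm]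
          exact h2.trans (le_abs_self _)
      have h2 : |(k : ℝ) - m| * (h / 2) ≤ K * (h / 2) := by
        calc |(k : ℝ) - m| * (h / 2) ≤ 4 := h1.trans hHk
          _ ≤ R + ε := by rw [hR]; linarith
          _ ≤ K * (h / 2) := hK
      have h3 : |(k : ℝ) - m| ≤ K := le_of_mul_le_mul_right h2 (by positivity)
      exact_mod_cast h3
    set y := barlowPos a' h s k i' j' - P with hy
    have hyS : y ∈ barlowStacking a' h s' :=
      (mem_barlowStacking_iff_sub_mem_shift (m := m) (i₀ := i) (j₀ := j) _).1 (barlowPos_mem _ _ _)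
    have hzp := hkey k i' j'
    have hny : ‖y‖ ≤ R := by
      have e : y = (barlowPosH a' H s k i' j' - p) -
          layerNormal (H k - H m - ((k : ℝ) - m) * h) := by rw [hzp, add_sub_cancel_right]
      calc ‖y‖ ≤ ‖barlowPosH a' H s k i' j' - p‖ +
            ‖(layerNormal (H k - H m - ((k : ℝ) - m) * h) : EuclideanSpace ℝ (Fin 3))‖ := by
            rw [e]; exact norm_sub_le _ _
        _ ≤ 4 + θ / 2 := add_le_add (by rw [← dist_eq_norm]; exact hz4) (hvert k hkm)
        _ = R := by rw [hR]
    obtain ⟨q, hq, hqd⟩ := hA2 y hyS hny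
    refine ⟨q, hq, ?_⟩
    rw [dist_eq_norm, ← sub_sub, hzp, add_sub_right_comm]
    calc ‖y - A q + layerNormal (H k - H m - ((k : ℝ) - m) * h)‖
        ≤ ‖y - A q‖ + ‖(layerNormal (H k - H m - ((k : ℝ) - m) * h) : EuclideanSpace ℝ (Fin 3))‖ :=
          norm_add_le _ _
      _ ≤ 2 * ε + θ / 2 := add_le_add (by rw [← dist_eq_norm]; exact hqd) (hvert k hkm)
      _ = θ := hθε

end Summit.AtomisticToContinuum.Crystallization.Theorems.HcpLandscapeGapBirth

end
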